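import Summits.ResolutionOfSingularities.ResolutionOfSingularities.Theorems.WildConesCampaignW46ThreefoldsCharTwoCurveLeaf
import Summits.ResolutionOfSingularities.ResolutionOfSingularities.Theorems.WildConesCampaignW46ThreefoldsCharTwoExactDrop

/-!
# [OURS · L1 W4.6, rung (ii) at p = 2] The hyperbolic-splitting regime of threefold hypersurface double
# points in characteristic two is CLOSED under the point-blow-up dynamics: forward transfer of
# isolatedness, the isolated/non-isolated DICHOTOMY, parity of μ, and the Milnor algebra `κ⟦X⟧/(X^μ)` —
# over EVERY field of characteristic 2

Cell res-hironaka (LADDER-RESOLUTION rung L, D-0089), slot W4.6 «restricted regimes as rungs», seat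
res-L1-s46-pv-4 (gen 2): «(ii) THREEFOLD HYPERSURFACES, second prover: the p = 2 hyperbolic-splitting
regime of `ClassicalRegimes` (n ≥ 3, order-2 cleaned states) as the disjoint strategy». Host: route
`WildCones`, crux `ClassicalRegimes` (stmt-ResolutionOfSingularities-16884; proved). Sequel to
`Theorems/WildConesCampaignW46ThreefoldsCharTwo{,ExactDrop,Family,Proof}.lean` (p467896, p471960,
p470498, p470616) of the same seat; second of three files (`…CurveLeaf`, this, `…Resolution`).

HONEST FRAMING. Everything here is OURS: theorems about route WildCones' own TYPED point-blow-up
dynamics (`Theorems/WildConesClassicalRegimesDefs.lean`: a state is the coefficient function `c` of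
`a = Σ c(A) u^A`, the atom is `z² = a(u₀,u₁,u₂)`; `step` = blow up the closed point, chart `u_i`, divide by
`u_i²`, translate by `τ`, delete square monomials; `MultP` = cleaned order `≥ 2` (a double point),
`OrdP` = a cleaned monomial of degree `2` — necessarily square-free, `u_j u_l`, `j ≠ l`: a HYPERBOLIC PAIR
of the quadratic form —, `Isol` = finite Milnor algebra, `mu` = `dim_κ κ⟦u⟧/(∂a)`). Together with the
third file it REPLACES THE ROLE of Th. 16.6 (2) Eq. (127) (H. Hironaka, ms. 2017-03-23, p.84 l.10–20)
and of the resolution conclusion of Th. 16.13 (p.87 l.26–30) in ONE regime — order-2-cleaned isolated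
double points of threefold hypersurfaces in characteristic `2` — with OUR invariant, the Milnor number.
NOTHING here is a statement of the manuscript [Hironaka2017] and nothing of it is used; no FACT-LIST
premise is used (the hyperbolic-pair reduction of Greuel–Pfister is a kernel theorem of the tree,
`WildCones.MuDropCharTwoOrdP.pair_reduction` / `descent` / `descent_step`). AI review is weaker than
expert review.

WHAT IS NEW (relative to p467896/p471960, which bound the number of consecutive FORCED states and give
the exact drop `μ' + 2 = μ` but leave open HOW the forced regime is left — by resolution or through a
non-isolated double point):

* `threefold_isol_step_of_ordP` — CLOSURE: over any field of characteristic `2`, if a state is an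
  order-2-cleaned isolated double point (`MultP ∧ OrdP ∧ Isol`) and its successor is still a double
  point (`MultP`), the successor is again ISOLATED — isolatedness transfers FORWARD along the dynamics
  in this regime (the tree had only the backward transfer `threefold_isol_of_forcedSuccessor`);
  `threefold_ordP_step_of_ordP` — and again order-2 cleaned (a hyperbolic pair away from the chart
  index survives the strict transform, `coeff_pair_ser_step`); `threefold_regime_step` — both, with the
  exact drop.
* `threefold_isol_step_iff_ordP` — THE DICHOTOMY, `PerfectField`-free: for an isolated double state
  whose successor is a double point, the successor is isolated IFF the state is order-2 cleaned. So the
  two strategies of crux `ClassicalRegimes` at `p = 2` act on DISJOINT, dynamically separated regimes: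
  order-2-cleaned states never produce a non-isolated singular point, states of cleaned order `≥ 3`
  leave the forced regime ONLY through non-isolated double points (`threefold_not_isol_step_of_not_ordP`,
  from the tree's `caseA_not_finite`). p467896's `threefold_ordTwo_of_forcedSuccessor` is the `→` half
  over a perfect field; `threefold_ordP_of_forcedSuccessor` drops `PerfectField`.
* `threefold_mu_even`, `threefold_two_le_mu`, `threefold_milnorAlgebra_equiv` — the Milnor algebra of an
  order-2-cleaned isolated double point is `κ⟦X⟧/(X^μ)` with `μ` EVEN, `μ ≥ 2` (`A_μ`-type bookkeeping:
  `threefold_exists_descent` to ONE variable, then the curve leaf).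
* `ser_step_ne_zero_of_ordP`, `ser_ne_zero_of_isol`, `exists_linear_of_not_multP` — leaving multiplicity
  two from this regime means acquiring a LINEAR cleaned monomial (a smooth point of the transform), never
  the zero (purely square, non-reduced) state.

References: G.-M. Greuel, G. Pfister, The splitting lemma in any characteristic, J. Algebra 689 (2026)
= arXiv:2507.17078, Thm 3.5 / Cor 3.7 [GreuelPfister2026] (through the tree's `pair_reduction`,
`descent_step`); H. Hironaka, ms. 2017, Th. 16.6 p.84, Th. 16.13 p.87 — quoted for the ROLE replaced
only, under adjudication, not cited as fact.
-/

noncomputable section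

-- single-problem summit: the doubled namespace component `ResolutionOfSingularities` is forced
set_option linter.dupNamespace false

open scoped BigOperators Classical

open MvPowerSeries

open Literature.AlgebraicGeometry.Resolution

namespace Summit.ResolutionOfSingularities.ResolutionOfSingularities.Theorems

namespace CampaignW46.ThreefoldsCharTwo

open WildCones WildCones.MuDropCharTwoOrdP

variable {κ : Type} [Field κ]

/-! ## Threefold double points in characteristic two: the blow-up-free descent to one variable -/

/-- [OURS · L1 W4.6; NOT a statement of the manuscript] **Descent of the Milnor algebra of an
order-2-cleaned double point to ONE variable** (threefold hypersurfaces `z² = a(u₀,u₁,u₂)`, any field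
of characteristic `2`): if the cleaned state has multiplicity two (`MultP`) and a quadratic monomial
(`OrdP`, a hyperbolic pair `u_j u_l`), its Milnor algebra `κ⟦u⟧/(∂a)` is `κ`-isomorphic to a
one-variable Milnor algebra `κ⟦X⟧/(g')` — the tree's formal inverse-function-theorem reduction of the
pair (`pair_reduction`) followed by killing the pair (`descent`). [cite: GreuelPfister2026, Thm 3.5 and Cor 3.7] -/
theorem threefold_exists_descent [CharP κ 2] {c : (Fin 3 → ℕ) → κ} (hM : MultP 2 3 κ c)
    (hO : OrdP 2 3 κ c) :
    ∃ g : MvPowerSeries (Fin 1) κ, Nonempty ((MvPowerSeries (Fin 3) κ ⧸ jac 2 3 κ c) ≃ₐ[κ]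
      (MvPowerSeries (Fin 1) κ ⧸ Ideal.span (Set.range fun t => MvPowerSeries.pderiv t g))) := by
  obtain ⟨j, l, hjl, hq⟩ := (ordP_two_iff_exists_pair c).mp hO
  have ha := (FormalCoordChange.two_le_order_iff _).mp (two_le_order_ser hM)
  obtain ⟨F, -, -, hJ, hdj, hdl, hXj, hXl⟩ := pair_reduction hjl hq (ha.2 j) (ha.2 l)
  obtain ⟨e, he⟩ := exists_emb_compl_pair hjl
  refine ⟨killCompl e (F.symm (ser 2 3 κ c)), ?_⟩
  rw [jac_eq_span_pderiv]
  exact descent e he F hJ hdj hdl hXj hXl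

/-- [OURS · L1 W4.6; NOT a statement of the manuscript] **PARITY: the Milnor number of an
order-2-cleaned isolated double point of a threefold hypersurface in characteristic two is EVEN**
(any field of characteristic `2`): `μ = dim_κ κ⟦X⟧/(g') = ord g'` for the one-variable descendant `g`,
and a derivative in characteristic two has even order. The non-vacuity family `z² = u₀u₁ + u₂^(2j+1)`
(p470498, `μ = 2j`) realises every even value. [folklore] -/
theorem threefold_mu_even [CharP κ 2] {c : (Fin 3 → ℕ) → κ} (hM : MultP 2 3 κ c) (hO : OrdP 2 3 κ c)
    (hI : Isol 2 3 κ c) : Even (mu 2 3 κ c) := by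
  obtain ⟨g, ⟨ε⟩⟩ := threefold_exists_descent hM hO
  haveI : Module.Finite κ (MvPowerSeries (Fin 3) κ ⧸ jac 2 3 κ c) := hI
  have hfin : Module.Finite κ (MvPowerSeries (Fin 1) κ ⧸
      Ideal.span (Set.range fun t => MvPowerSeries.pderiv t g)) := Module.Finite.equiv ε.toLinearEquiv
  change Even (Module.finrank κ (MvPowerSeries (Fin 3) κ ⧸ jac 2 3 κ c))
  rw [ε.toLinearEquiv.finrank_eq]
  exact curve_milnor_even hfin

/-- [OURS · L1 W4.6; NOT a statement of the manuscript] An order-2-cleaned isolated double point of a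
threefold hypersurface in characteristic two has `μ ≥ 2` (`μ ≥ 1` by `mu_pos`, and `μ` is even).
[folklore] -/
theorem threefold_two_le_mu [CharP κ 2] {c : (Fin 3 → ℕ) → κ} (hM : MultP 2 3 κ c) (hO : OrdP 2 3 κ c)
    (hI : Isol 2 3 κ c) : 2 ≤ mu 2 3 κ c := by
  have h1 := mu_pos (p := 2) le_rfl hI hM
  obtain ⟨k, hk⟩ := threefold_mu_even hM hO hI
  omega

/-- [OURS · L1 W4.6; NOT a statement of the manuscript] **The Milnor algebra of an order-2-cleaned
isolated double point of a threefold hypersurface in characteristic two is the truncated polynomial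
ring `κ⟦X⟧/(X^μ)`** (monogenic, `A_μ`-type bookkeeping), over any field of characteristic `2`.
[cite: GreuelPfister2026, Thm 3.5 and Cor 3.7] -/
theorem threefold_milnorAlgebra_equiv [CharP κ 2] {c : (Fin 3 → ℕ) → κ} (hM : MultP 2 3 κ c)
    (hO : OrdP 2 3 κ c) (hI : Isol 2 3 κ c) :
    Nonempty ((MvPowerSeries (Fin 3) κ ⧸ jac 2 3 κ c) ≃ₐ[κ]
      (MvPowerSeries (Fin 1) κ ⧸ Ideal.span {(X 0 : MvPowerSeries (Fin 1) κ) ^ mu 2 3 κ c})) := by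
  obtain ⟨g, ⟨ε⟩⟩ := threefold_exists_descent hM hO
  haveI : Module.Finite κ (MvPowerSeries (Fin 3) κ ⧸ jac 2 3 κ c) := hI
  have hfin : Module.Finite κ (MvPowerSeries (Fin 1) κ ⧸
      Ideal.span (Set.range fun t => MvPowerSeries.pderiv t g)) := Module.Finite.equiv ε.toLinearEquiv
  have hμ : mu 2 3 κ c = Module.finrank κ (MvPowerSeries (Fin 1) κ ⧸
      Ideal.span (Set.range fun t => MvPowerSeries.pderiv t g)) := by
    change Module.finrank κ (MvPowerSeries (Fin 3) κ ⧸ jac 2 3 κ c) = _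
    rw [ε.toLinearEquiv.finrank_eq]
  rw [hμ]
  exact ⟨ε.trans (Ideal.quotientEquivAlgOfEq κ (curve_span_pderiv_eq_span_X_pow hfin))⟩

/-! ## The dictionary entry: quadratic monomials away from the chart index survive the step -/

/-- [OURS · L1 W4.6] **The strict transform keeps the quadratic monomials away from the chart index**
(every `n`, characteristic `2`): for a state `c` of multiplicity two and `j ≠ l` both `≠ i`, the cleaned
successor `step i τ c` has the same coefficient at `u_j u_l` as the cleaned state (`coeff_pair_strict`
through the dictionary `X_pow_mul_serT_eq_subst`; the monomial `u_j u_l` is not a square, so the final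
cleaning keeps it). [folklore] -/
theorem coeff_pair_ser_step [CharP κ 2] {n : ℕ} (c : (Fin n → ℕ) → κ) (i : Fin n) (τ : Fin n → κ)
    (hM : MultP 2 n κ c) {j l : Fin n} (hjl : j ≠ l) (hj : j ≠ i) (hl : l ≠ i) :
    coeff (Finsupp.single j 1 + Finsupp.single l 1) (ser 2 n κ (step 2 n κ i τ c)) =
      coeff (Finsupp.single j 1 + Finsupp.single l 1) (ser 2 n κ c) := by
  rw [coeff_ser_step c i τ hM]
  have hj1 : ¬ 2 ∣ (⇑(Finsupp.single j 1 + Finsupp.single l 1 : Fin n →₀ ℕ)) j := by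
    simp [Ne.symm hjl]
  rw [OrdPExitSurface.clean_apply_of_not_dvd _ _ j hj1]
  exact coeff_pair_strict i τ (two_le_order_ser hM) (X_pow_mul_serT_eq_subst c i τ hM) hjl hj hl

/-- [OURS · L1 W4.6] **An order-2-cleaned double state has a NON-ZERO successor** (every `n`,
characteristic `2`, any chart and translation): either a hyperbolic pair away from the chart index
survives (`coeff_pair_ser_step`), or every pair passes through the chart index and then the strict
transform has a non-zero LINEAR term (`exists_pair_ne`, contrapositive), which cleaning keeps. So leaving
multiplicity two from this regime means acquiring a linear monomial — a smooth point — never the zero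
(purely-square, non-reduced) state. [folklore] -/
theorem ser_step_ne_zero_of_ordP [CharP κ 2] {n : ℕ} (c : (Fin n → ℕ) → κ) (i : Fin n) (τ : Fin n → κ)
    (hM : MultP 2 n κ c) (hO : OrdP 2 n κ c) : ser 2 n κ (step 2 n κ i τ c) ≠ 0 := by
  intro h0
  have hlin : ∀ m, coeff (Finsupp.single m 1) (show MvPowerSeries (Fin n) κ from
      fun A : Fin n →₀ ℕ => tr n κ i τ 2 (dv n κ i 2 (bl n κ i (clean 2 n κ c))) ⇑A) = 0 := by
    intro m
    have h := congrArg (coeff (Finsupp.single m 1)) h0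
    have hm1 : ¬ 2 ∣ (⇑(Finsupp.single m 1 : Fin n →₀ ℕ)) m := by simp
    rw [map_zero, coeff_ser_step c i τ hM, OrdPExitSurface.clean_apply_of_not_dvd _ _ m hm1] at h
    exact h
  obtain ⟨j, l, hjl, hj, hl, hq⟩ := exists_pair_ne i τ (two_le_order_ser hM)
    (X_pow_mul_serT_eq_subst c i τ hM) hlin ((ordP_two_iff_exists_pair c).mp hO)
  have h := coeff_pair_ser_step c i τ hM hjl hj hl
  rw [h0, map_zero] at h
  exact hq h.symm

/-- [OURS · L1 W4.6] An isolated state in `n ≥ 1` variables has a non-zero cleaned series (the zero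
series has Jacobian ideal `0` and the infinite Milnor algebra `κ⟦u⟧`). [folklore] -/
theorem ser_ne_zero_of_isol {p n : ℕ} (hn : 0 < n) {c : (Fin n → ℕ) → κ} (hI : Isol p n κ c) :
    ser p n κ c ≠ 0 := by
  intro h0
  rw [isol_iff_finite_pderiv, h0] at hI
  have hbot : Ideal.span (Set.range fun s : Fin n => MvPowerSeries.pderiv s (0 : MvPowerSeries (Fin n) κ)) =
      Ideal.span (((∅ : Finset (MvPowerSeries (Fin n) κ)) : Set (MvPowerSeries (Fin n) κ))) := by
    rw [Finset.coe_empty, Ideal.span_empty, Ideal.span_eq_bot]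
    rintro x ⟨s, rfl⟩
    exact map_zero _
  rw [hbot] at hI
  exact not_finite_quot_span (n := n) (κ := κ) ∅ (by simp) (by simpa using hn) hI

/-- [OURS · L1 W4.6] **Multiplicity `< 2` with a non-zero cleaned series means a LINEAR monomial**: the
cleaned series has no constant term (the zero exponent is a square exponent), so a non-zero cleaned state
that is not of multiplicity two has a monomial of degree exactly `1` — the transform `z² + ℓ(u) + …` is
SMOOTH at the visited point. [folklore] -/
theorem exists_linear_of_not_multP {n : ℕ} {c : (Fin n → ℕ) → κ} (hne : ser 2 n κ c ≠ 0)
    (hM : ¬ MultP 2 n κ c) : ∃ A, clean 2 n κ c A ≠ 0 ∧ Finset.sum Finset.univ (fun j => A j) = 1 := by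
  have hex : ∃ A, clean 2 n κ c A ≠ 0 := by
    by_contra h
    push Not at h
    exact hne (MvPowerSeries.ext fun A => by rw [coeff_ser, map_zero]; exact h ⇑A)
  unfold MultP at hM
  rw [not_and, not_forall] at hM
  obtain ⟨A, hA⟩ := hM hex
  rw [Classical.not_imp, not_le] at hA
  refine ⟨A, hA.1, ?_⟩
  have hpos : Finset.sum Finset.univ (fun j => A j) ≠ 0 := by
    intro hzero
    apply hA.1
    apply OrdPExitSurface.clean_apply_of_dvd
    intro l
    have : A l = 0 := by
      have := Finset.single_le_sum (f := A) (fun _ _ => Nat.zero_le _) (Finset.mem_univ l)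
      omega
    rw [this]
    exact dvd_zero 2
  omega

/-! ## Closure of the hyperbolic-splitting regime under the dynamics -/

/-- [OURS · L1 W4.6 rung (ii) at `p = 2`; NOT a statement of the manuscript] **Order-2-cleanedness
propagates**: over any field of characteristic `2`, if a double state of `z² = a(u₀,u₁,u₂)` is order-2
cleaned (`OrdP`: a hyperbolic pair `u_j u_l` in the cleaned quadratic form) and its point-blow-up
successor is again a double point (`MultP`), then the successor is order-2 cleaned: a hyperbolic pair
away from the chart index exists (`exists_pair_ne` — a pair through the chart index alone would leave a
linear term) and survives the step (`coeff_pair_ser_step`). Isolatedness is not needed. [folklore] -/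
theorem threefold_ordP_step_of_ordP [CharP κ 2] (c : (Fin 3 → ℕ) → κ) (i : Fin 3) (τ : Fin 3 → κ)
    (hM : MultP 2 3 κ c) (hO : OrdP 2 3 κ c) (hM' : MultP 2 3 κ (step 2 3 κ i τ c)) :
    OrdP 2 3 κ (step 2 3 κ i τ c) := by
  obtain ⟨j, l, hjl, hj, hl, hq⟩ := exists_pair_ne i τ (two_le_order_ser hM)
    (X_pow_mul_serT_eq_subst c i τ hM) (coeff_single_serT le_rfl c i τ hM hM')
    ((ordP_two_iff_exists_pair c).mp hO)
  exact (ordP_two_iff_exists_pair _).mpr ⟨j, l, hjl, by rwa [coeff_pair_ser_step c i τ hM hjl hj hl]⟩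

/-- [OURS · L1 W4.6 rung (ii) at `p = 2`; NOT a statement of the manuscript] **Isolatedness transfers
FORWARD in the hyperbolic-splitting regime**: over any field of characteristic `2`, if a state of
`z² = a(u₀,u₁,u₂)` is an order-2-cleaned isolated double point (`MultP ∧ OrdP ∧ Isol`) and its
point-blow-up successor (chart `i`, translation `τ`) is again a double point (`MultP`), then the
successor is ISOLATED. Proof: the hyperbolic pair away from the chart index lets the tree's
`descent_step` pass — compatibly with the blow-up relation `u_i² G = a∘Φ_{i,τ}` — to ONE variable with
isomorphic Milnor algebras on both sides, and in one variable `a' = X² G'` transfers finiteness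
(`curve_finite_strict`). Hence the procedure, started in this regime, NEVER produces a non-isolated
singular point: it stays in the regime or resolves. [cite: GreuelPfister2026, Thm 3.5 and Cor 3.7] -/
theorem threefold_isol_step_of_ordP [CharP κ 2] (c : (Fin 3 → ℕ) → κ) (i : Fin 3) (τ : Fin 3 → κ)
    (hM : MultP 2 3 κ c) (hO : OrdP 2 3 κ c) (hI : Isol 2 3 κ c)
    (hM' : MultP 2 3 κ (step 2 3 κ i τ c)) : Isol 2 3 κ (step 2 3 κ i τ c) := by
  obtain ⟨G, ha, hG0, hG, hj, hj'⟩ := dictCharTwo c i τ hM hM'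
  obtain ⟨j, l, hjl, hji, hli, hq⟩ := exists_pair_ne i τ ha hG hG0 ((ordP_two_iff_exists_pair c).mp hO)
  obtain ⟨e, i', he, hi', -⟩ := exists_compl_embedding hjl (Ne.symm hji) (Ne.symm hli)
  obtain ⟨a', G', -, -, hG', ⟨εa⟩, ⟨εG⟩⟩ := descent_step i τ ha hG0 hG hjl hji hli hq e he i' hi'
  change Module.Finite κ (MvPowerSeries (Fin 3) κ ⧸ jac 2 3 κ c) at hI
  change Module.Finite κ (MvPowerSeries (Fin 3) κ ⧸ jac 2 3 κ (step 2 3 κ i τ c))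
  rw [hj] at hI
  rw [hj']
  haveI := hI
  have hfa' : Module.Finite κ (MvPowerSeries (Fin (3 - 2)) κ ⧸
      Ideal.span (Set.range fun t => MvPowerSeries.pderiv t a')) := Module.Finite.equiv εa.toLinearEquiv
  have hfG' : Module.Finite κ (MvPowerSeries (Fin (3 - 2)) κ ⧸
      Ideal.span (Set.range fun t => MvPowerSeries.pderiv t G')) :=
    curve_finite_strict i' (fun t => τ (e t)) hG' hfa'
  exact Module.Finite.equiv εG.symm.toLinearEquiv

/-- [OURS · L1 W4.6 rung (ii) at `p = 2`; NOT a statement of the manuscript] **CLOSURE OF THE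
HYPERBOLIC-SPLITTING REGIME, with the exact drop**: over any field of characteristic `2`, an
order-2-cleaned isolated double point of `z² = a(u₀,u₁,u₂)` whose point-blow-up successor is a double
point has as successor again an order-2-cleaned isolated double point, with Milnor number SMALLER BY
EXACTLY TWO. [cite: GreuelPfister2026, Thm 3.5 and Cor 3.7] -/
theorem threefold_regime_step [CharP κ 2] (c : (Fin 3 → ℕ) → κ) (i : Fin 3) (τ : Fin 3 → κ)
    (hM : MultP 2 3 κ c) (hO : OrdP 2 3 κ c) (hI : Isol 2 3 κ c)
    (hM' : MultP 2 3 κ (step 2 3 κ i τ c)) :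
    OrdP 2 3 κ (step 2 3 κ i τ c) ∧ Isol 2 3 κ (step 2 3 κ i τ c) ∧
      mu 2 3 κ (step 2 3 κ i τ c) + 2 = mu 2 3 κ c :=
  have hI' := threefold_isol_step_of_ordP c i τ hM hO hI hM'
  ⟨threefold_ordP_step_of_ordP c i τ hM hO hM', hI', threefold_muDrop_eq κ c i τ hM hI' hM'⟩

/-! ## The dichotomy: the two strategies of `ClassicalRegimes` at `p = 2` never meet -/

/-- [OURS · L1 W4.6 rung (ii) at `p = 2`; NOT a statement of the manuscript] **States of cleaned order
`≥ 3` leave the forced regime only through NON-isolated double points** (any field of characteristic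
`2`): if a double state of `z² = a(u₀,u₁,u₂)` is NOT order-2 cleaned and its successor is a double
point, the successor is not isolated (`caseA_not_finite`: without a hyperbolic pair, `(∂G) ⊆ (u_i, ∂_i G)`).
`PerfectField`-free form of the crux's Case-A / high-order exits. [folklore] -/
theorem threefold_not_isol_step_of_not_ordP [CharP κ 2] (c : (Fin 3 → ℕ) → κ) (i : Fin 3)
    (τ : Fin 3 → κ) (hM : MultP 2 3 κ c) (hO : ¬ OrdP 2 3 κ c) (hM' : MultP 2 3 κ (step 2 3 κ i τ c)) :
    ¬ Isol 2 3 κ (step 2 3 κ i τ c) := by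
  obtain ⟨G, ha, hG0, hG, -, hj'⟩ := dictCharTwo c i τ hM hM'
  have hnopair : ∀ j l : Fin 3, j ≠ l →
      coeff (Finsupp.single j 1 + Finsupp.single l 1) (ser 2 3 κ c) = 0 := by
    intro j l hjl
    by_contra h
    exact hO ((ordP_two_iff_exists_pair c).mpr ⟨j, l, hjl, h⟩)
  change ¬ Module.Finite κ (MvPowerSeries (Fin 3) κ ⧸ jac 2 3 κ (step 2 3 κ i τ c))
  rw [hj']
  exact caseA_not_finite le_rfl i τ ha hG hG0 hnopair

/-- [OURS · L1 W4.6 rung (ii) at `p = 2`, THE DICHOTOMY; NOT a statement of the manuscript] Over any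
field of characteristic `2`: for an ISOLATED double state of `z² = a(u₀,u₁,u₂)` whose point-blow-up
successor is a double point, **the successor is isolated IFF the state is order-2 cleaned**. The two
strategies of crux `ClassicalRegimes` at `p = 2` (hyperbolic splitting for order-2-cleaned states,
Case-A exit for cleaned order `≥ 3`) therefore act on dynamically SEPARATED regimes: the first never
creates a non-isolated singular point, the second exits the forced regime only through one.
`PerfectField`-free (p467896's `threefold_ordTwo_of_forcedSuccessor` is the `→` half over a perfect
field). [folklore] -/
theorem threefold_isol_step_iff_ordP [CharP κ 2] (c : (Fin 3 → ℕ) → κ) (i : Fin 3) (τ : Fin 3 → κ)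
    (hM : MultP 2 3 κ c) (hI : Isol 2 3 κ c) (hM' : MultP 2 3 κ (step 2 3 κ i τ c)) :
    Isol 2 3 κ (step 2 3 κ i τ c) ↔ OrdP 2 3 κ c :=
  ⟨fun hI' => by
    by_contra hO
    exact threefold_not_isol_step_of_not_ordP c i τ hM hO hM' hI',
  fun hO => threefold_isol_step_of_ordP c i τ hM hO hI hM'⟩

/-- [OURS · L1 W4.6 rung (ii) at `p = 2`; NOT a statement of the manuscript] `PerfectField`-free form
of p467896's regime lemma: a double state with a FORCED (isolated double) successor is order-2 cleaned.
[folklore] -/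
theorem threefold_ordP_of_forcedSuccessor [CharP κ 2] (c : (Fin 3 → ℕ) → κ) (i : Fin 3)
    (τ : Fin 3 → κ) (hM : MultP 2 3 κ c) (hI' : Isol 2 3 κ (step 2 3 κ i τ c))
    (hM' : MultP 2 3 κ (step 2 3 κ i τ c)) : OrdP 2 3 κ c := by
  by_contra hO
  exact threefold_not_isol_step_of_not_ordP c i τ hM hO hM' hI'

/-! ## Every dimension: order-2-cleanedness propagates (appended 2026-08-27) -/

/-- [OURS · L1 W4.6; NOT a statement of the manuscript] **Order-2-cleanedness propagates in EVERY
dimension `n`** (hypersurface double points `z² = a(u₁,…,uₙ)`, any field of characteristic `2`): if a double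
state is order-2 cleaned (a hyperbolic pair `u_j u_l` in the cleaned quadratic form) and its point-blow-up
successor is again a double point, the successor is order-2 cleaned — a hyperbolic pair away from the chart
index exists (`exists_pair_ne`) and survives (`coeff_pair_ser_step`). The `n = 3` instance is
`threefold_ordP_step_of_ordP`; what is special to threefolds is the transfer of ISOLATEDNESS
(`threefold_isol_step_of_ordP`), not of the order. [folklore] -/
theorem hypersurface_ordP_step_of_ordP [CharP κ 2] {n : ℕ} (c : (Fin n → ℕ) → κ) (i : Fin n)
    (τ : Fin n → κ) (hM : MultP 2 n κ c) (hO : OrdP 2 n κ c) (hM' : MultP 2 n κ (step 2 n κ i τ c)) :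
    OrdP 2 n κ (step 2 n κ i τ c) := by
  obtain ⟨j, l, hjl, hj, hl, hq⟩ := exists_pair_ne i τ (two_le_order_ser hM)
    (X_pow_mul_serT_eq_subst c i τ hM) (coeff_single_serT le_rfl c i τ hM hM')
    ((ordP_two_iff_exists_pair c).mp hO)
  exact (ordP_two_iff_exists_pair _).mpr ⟨j, l, hjl, by rwa [coeff_pair_ser_step c i τ hM hjl hj hl]⟩

/-- [OURS · L1 W4.6; NOT a statement of the manuscript] **Along a run, in every dimension**: from an
order-2-cleaned state, as long as the states are double points they stay order-2 cleaned. [folklore] -/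
theorem hypersurface_ordP_run [CharP κ 2] {n : ℕ} (c₀ : (Fin n → ℕ) → κ) (i : ℕ → Fin n)
    (t : ℕ → Fin n → κ) (hO₀ : OrdP 2 n κ c₀) {M : ℕ} (hrun : ∀ m ≤ M, MultP 2 n κ (run 2 n κ c₀ i t m)) :
    ∀ m ≤ M, OrdP 2 n κ (run 2 n κ c₀ i t m) := by
  intro m
  induction m with
  | zero => intro _; exact hO₀
  | succ m ih =>
    intro hm
    exact hypersurface_ordP_step_of_ordP _ (i m) (t m) (hrun m (by omega)) (ih (by omega)) (hrun (m + 1) hm)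

end CampaignW46.ThreefoldsCharTwo

end Summit.ResolutionOfSingularities.ResolutionOfSingularities.Theorems

end
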